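import Mathlib

/-!
# HyperellipticTheta — the even theta form of the hyperelliptic involution on `J[2] = 𝔽₂⁶` (genus 3)

Solo-blind programme, session s55, `work/s55/presentation-branches.md` §7 (THEOREM HM) and
`work/s54/prym-side.md` (PROPOSITION HP); claims SB-C532 ff.

Setting.  A `Q₈`-structure `φ : π₁(C) ↠ Q₈` on a genus-3 curve determines the isotropic plane
`V(φ) = φ mod centre ⊂ H₁(C, 𝔽₂) ≅ 𝔽₂⁶` (315 planes, 16 structures over each, 5040 in all).  In the
s27/s55 topological model the hyperelliptic involution `ι` of the certified maximal chain
`(a₁, b₁, γ₁₂, b₂, c₅, b₃, a₃)` fixes exactly the 3360 structures lying over the 210 planes on which the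
quadratic form
`q(x) = Σᵢ x_{aᵢ} x_{bᵢ} + v·x`, `v = (1,1,1,0,1,1)`,
is not identically zero, and none over the 105 planes on which it vanishes (computed there; `q` is the
form of the hyperelliptic even theta characteristic in these coordinates).  THEOREM HM(a): these two
sets are the two `SMod(ι)`-orbits, i.e. the hyperelliptic locus of `M₃(Q₈)` has exactly two components.

What this file certifies (closed Boolean computations, `decide`), with vectors coded by `n < 64`
(bit `2i` = coordinate `a_{i+1}`, bit `2i+1` = coordinate `b_{i+1}`):

* `q_refines` : `q(x + y) = q(x) + q(y) + B(x,y)` for the intersection form `B` — `q` is a quadratic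
  refinement of `B`;
* `q_even` : `q` has exactly 36 zeros (an even characteristic; Arf invariant 0);
* `isotropic_pairs` : there are `1890 = 6 · 315` ordered pairs of distinct non-zero `B`-orthogonal
  vectors (each isotropic plane counted 6 times);
* `totally_singular_pairs` / `nonsingular_pairs` : exactly `630 = 6 · 105` of them span a plane on
  which `q ≡ 0` and `1260 = 6 · 210` a plane on which `q ≢ 0` — the `105 / 210` dichotomy
  (`1680 = 16 · 105`, `3360 = 16 · 210`);
* `q_on_chain` : the values of `q` on the classes of the seven chain curves
  `a₁, b₁, a₁+a₂, b₂, a₂+a₃, b₃, a₃` are `1,1,0,0,0,1,1`.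

What is NOT certified here: the topological computation itself (the chain relations in `Aut π₁`, the
involution, its fixed structures, the orbit count and the monodromy Lie algebras), which is exact
integer / finite-field linear algebra in `work/s55/hyper_monodromy.py`, `chain_exact.py`.
-/

set_option linter.dupNamespace false
set_option maxRecDepth 8192

namespace Summit.HodgeConjecture.HodgeConjecture.Theorems.HyperellipticTheta

/-- Coordinate `i` of the vector coded by `x`. -/
def bit (x i : ℕ) : Bool := x.testBit i

/-- The intersection form on `𝔽₂⁶` in the basis `a₁,b₁,a₂,b₂,a₃,b₃`. -/
def B (x y : ℕ) : Bool :=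
  (List.range 3).foldl (fun acc i =>
    acc ^^ ((bit x (2*i) && bit y (2*i+1)) ^^ (bit x (2*i+1) && bit y (2*i)))) false

/-- The characteristic vector `v = (1,1,1,0,1,1)`, coded as `1 + 2 + 4 + 16 + 32 = 55`. -/
def v : ℕ := 55

/-- The hyperelliptic even theta form `q(x) = Σ x_{aᵢ} x_{bᵢ} + v·x`. -/
def q (x : ℕ) : Bool :=
  (List.range 3).foldl (fun acc i => acc ^^ (bit x (2*i) && bit x (2*i+1))) false
    ^^ (List.range 6).foldl (fun acc i => acc ^^ (bit x i && bit v i)) false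

/-- `q` is a quadratic refinement of the intersection form. -/
theorem q_refines :
    ((List.range 64).all fun x => (List.range 64).all fun y =>
      q (x ^^^ y) == (q x ^^ q y ^^ B x y)) = true := by
  decide

/-- `q` is even: 36 zeros (and 28 non-zeros) on `𝔽₂⁶`. -/
theorem q_even : ((List.range 64).filter fun x => !q x).length = 36 := by
  decide

/-- Number of `y < 64` such that `(x, y)` is an ordered pair of distinct non-zero `B`-orthogonal
vectors satisfying the extra condition `c x y`. -/
def rowCount (c : ℕ → ℕ → Bool) (x : ℕ) : ℕ :=
  ((List.range 64).filter fun y => x != 0 && y != 0 && x != y && !B x y && c x y).length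

/-- Sum of `rowCount c x` over `x < 64`: the number of ordered isotropic pairs satisfying `c`. -/
def pairCount (c : ℕ → ℕ → Bool) : ℕ :=
  (List.range 64).foldl (fun acc x => acc + rowCount c x) 0

/-- Ordered pairs of distinct non-zero orthogonal vectors: `6 · 315` (each isotropic plane 6 times). -/
theorem isotropic_pairs : pairCount (fun _ _ => true) = 1890 := by
  decide

/-- Pairs spanning a totally `q`-singular plane: `6 · 105`. -/
theorem totally_singular_pairs :
    pairCount (fun x y => !q x && !q y && !q (x ^^^ y)) = 630 := by
  decide

/-- Pairs spanning a plane on which `q` is not identically zero: `6 · 210`. -/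
theorem nonsingular_pairs :
    pairCount (fun x y => q x || q y || q (x ^^^ y)) = 1260 := by
  decide

/-- The structure counts of PROPOSITION HP / THEOREM HM(a). -/
theorem structure_counts : 16 * 210 = 3360 ∧ 16 * 105 = 1680 ∧ 3360 + 1680 = 5040 := by
  decide

/-- `q` on the classes of the chain curves `a₁, b₁, a₁+a₂, b₂, a₂+a₃, b₃, a₃`
(codes `1, 2, 5, 8, 20, 32, 16`). -/
theorem q_on_chain :
    [q 1, q 2, q 5, q 8, q 20, q 32, q 16] = [true, true, false, false, false, true, true] := by
  decide

end Summit.HodgeConjecture.HodgeConjecture.Theorems.HyperellipticTheta
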